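import Mathlib
import Summits.Langlands.Langlands.Theses.PicardMuOrdinary
import Literature.NumberTheory.GaloisRepresentations.GaloisRep
import Literature.NumberTheory.GaloisRepresentations.AbsGaloisOuterConj
import Literature.NumberTheory.GaloisRepresentations.OrdinaryRegular
import Literature.NumberTheory.GaloisRepresentations.NearlyOrdinaryDeformationRing
import Literature.NumberTheory.GaloisRepresentations.SuperellipticTorsionRep
import Literature.NumberTheory.GaloisRepresentations.CubicResidueSymbol
import Literature.NumberTheory.Automorphic.ReciprocityGLn
import Literature.NumberTheory.Automorphic.ReciprocityGLnProofs
import Literature.RingTheory.KrullDimension.AffineDimension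
import Summits.Langlands.Langlands.Theorems.PicardMuOrdinaryMuOrdinaryFamilyRTAccumulation
import Summits.Langlands.Langlands.Theorems.PicardMuOrdinaryMuOrdinaryFamilyRTDictionary
import Summits.Langlands.Langlands.Theorems.PicardMuOrdinaryMuOrdinaryFamilyRTPicardInput
import Summits.Langlands.Langlands.Theorems.PicardMuOrdinaryMuOrdinaryFamilyRTQuadraticDescent
import HarnessLib

/-!
# Crux `MuOrdinaryFamilyRT` (stmt-Langlands-13757), line `char-zero-dominance`: the typed vocabulary,
# the dominance lemma, and the statements of the open stubs K2 / K1 / remainder (Defs file)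

This file LANDS, verbatim from the registered gen-2 skeleton `Cruxes/MuOrdinaryFamilyRT/Lines/char_zero_dominance.lean`
(planner-cruxplan-…-char-zero-dominance-g2-0; leads prover-line-stmt-Langlands-13757-b-0 and -c1-0; registration
bb82db47), the line's typed notions and the STATEMENTS of its open stubs, so that (i) the reduction
"`MuOrdinaryFamilyRT` ⇐ stubs" can be kernel-checked in the tree (companion `…CharZeroReduction.lean`) and (ii) the
tenure planner can promote the two crux-sized-but-smaller stubs to items that cite tree declarations:

* § 0 `ResidualHyp`, `LimitConcl`, `crux_iff` (`Iff.rfl`: the crux is `∀ f hcpt, generic → ResidualHyp → LimitConcl`);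
* § 2 the framed heart `rbar f B : Γ_K → GL₃(𝔽₃)` (`heartRep` of `SuperellipticTorsionRep` on `𝔽₃^{roots}/diag`), `IsUpper3`;
* § 2b the Galois-side SCOPE `IsMuOrdinaryAtThree ρ` (gen 2; replaces the curve-level `HasMuOrdinaryReductionAtThree f`,
  which is empty on `ℤ[x]`, `Negative/ScopeVacuity`) and `MainClass f ρ_C`;
* § 3 `OrdFamily f ι e S₀ ρ_C` — an integral `Λ`-adic B-ordinary polarized family of `Γ_K`-representations through `ρ_C`;
* § 4 the dominance lemma `algebraMap_injective_of_ringKrullDim_le` (proved);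
* § 5 the statements `S.stub_charZeroFamily` (K2: the characteristic-zero count gives a 4-dimensional `OrdFamily`),
  `S.stub_definiteHost` (K1: finiteness over `Λ` + classicality of arithmetic points over `F' = K(√d)`; RESHAPED by the
  third lead with the hypothesis `4 ≤ ringKrullDim 𝓕.R`, without which it is false in truth by the constant family
  `R = Λ = 𝒪`), `S.stub_remainder` (the conceded complement), and the two fact stubs `S.stub_picardFact`,
  `S.stub_descentFacts` (Literature debts of the landed conditional Stubs 1 and 5).

Already landed in this namespace and imported: `K`, `S.stub_dictionary`/`stub_dictionary` (p85480), `Generic`, `PicardInput`,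
`S.stub_picardInput`/`stub_picardInput_of` (p86963), `S.stub_accumulation`/`stub_accumulation` (p85419),
`S.stub_quadraticDescent`/`stub_quadraticDescent_of` (p90012).  Nothing here is proved except § 4 and `crux_iff`; the long
rationale of every notion (intended witnesses, why-it-might-fail, sources: Kisin 2008 §2.3, Allen arXiv:1411.7661,
Geraghty 2019 §3, CHT 2008 §2, BLGGT 2014, Thorne 2012/2017, Chenevier determinants, BBW 2017) is in the skeleton's
docstrings and in the evidence files `stub_charZeroFamily_report.md` / `stub_definiteHost_analysis.md` of the item.
-/

set_option linter.dupNamespace false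

namespace Summit.Langlands.Langlands.Cruxes.MuOrdinaryFamilyRT.CharZeroDominance

open scoped NumberField Polynomial Matrix Classical
open Field IsDedekindDomain Polynomial
open Literature.NumberTheory.GaloisRepresentations Literature.NumberTheory.Automorphic

noncomputable section

/-! ## 0. The base field and the crux, cut into hypothesis and conclusion -/

/-- `K = ℚ(ω)` is Galois over `ℚ` (needed by `absGaloisOuterConj ℚ K` in `OrdFamily.polarized`). -/
instance instIsGaloisK : IsGalois ℚ K := by
  haveI : IsCyclotomicExtension {3} ℚ K := CyclotomicField.isCyclotomicExtension 3 ℚ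
  exact IsCyclotomicExtension.isGalois {3} ℚ K

/-- The crux's residual-automorphy hypothesis, VERBATIM (consumed only by `stub_remainder`: inside the
main class the polarized ordinary seed over `F'` is part of `stub_definiteHost`). -/
def ResidualHyp (f : ℤ[X]) (hcpt : isCompact_glFiniteIntegralLevel 3 (CyclotomicField 3 ℚ)) : Prop :=
  ∃ (P : Literature.NumberTheory.Automorphic.CuspidalAutomorphicRepData 3 (CyclotomicField 3 ℚ) hcpt) (𝔐 : Ideal (integralClosure ℤ ℂ)), P.1.IsRegularAlgebraic ∧ 𝔐.IsMaximal ∧ (3 : (integralClosure ℤ ℂ)) ∈ 𝔐 ∧ ∀ᶠ 𝔭 : IsDedekindDomain.HeightOneSpectrum (NumberField.RingOfIntegers (CyclotomicField 3 ℚ)) in Filter.cofinite, ∃ (α : Multiset ℂ) (Q : Polynomial (integralClosure ℤ ℂ)), P.1.HasSatakeParamAt 𝔭 α ∧ Q.map (algebraMap (integralClosure ℤ ℂ) ℂ) = (α.map (fun a => Polynomial.X - Polynomial.C ((𝔭.residueCard : ℂ) * a))).prod ∧ Q.map (Ideal.Quotient.mk 𝔐) = (if (f.map ((Ideal.Quotient.mk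 𝔭.asIdeal).comp (algebraMap ℤ (NumberField.RingOfIntegers (CyclotomicField 3 ℚ))))).roots.toFinset.card = 4 then (Polynomial.X - 1) ^ 3 else if (f.map ((Ideal.Quotient.mk 𝔭.asIdeal).comp (algebraMap ℤ (NumberField.RingOfIntegers (CyclotomicField 3 ℚ))))).roots.toFinset.card = 2 then (Polynomial.X - 1) ^ 2 * (Polynomial.X + 1) else if (f.map ((Ideal.Quotient.mk 𝔭.asIdeal).comp (algebraMap ℤ (NumberField.RingOfIntegers (CyclotomicField 3 ℚ))))).roots.toFinset.card = 1 then Polynomial.X ^ 3 - 1 else if (∃ y : ((NumberField.RingOfIntegers (CyclotomicField 3 ℚ)) ⧸ 𝔭.asIdeal), y ^ 2 = (f.map ((Ideal.Quotient.mk 𝔭.asIdeal).comp (algebraMap ℤ (NumberField.RingOfIntegers (CyclotomicField 3 ℚ))))).discr) then (Polynomial.X - 1) * (Polynomial.X + 1) ^ 2 else Polynomial.X ^ 3 + Polynomial.X ^ 2 + Polynomial.X + 1 : Polynomial ℤ).map (Int.castRingHom ((integralClosure ℤ ℂ) ⧸ 𝔐))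

/-- The crux's conclusion, VERBATIM: `ρ_C` is a 3-adic limit of regular algebraic cuspidal `P_k`. -/
def LimitConcl (f : ℤ[X]) (hcpt : isCompact_glFiniteIntegralLevel 3 (CyclotomicField 3 ℚ)) : Prop :=
  ∃ (e : CyclotomicField 3 ℚ →+* ℂ) (𝔐 : Ideal (integralClosure ℤ ℂ)) (S : Finset (IsDedekindDomain.HeightOneSpectrum (NumberField.RingOfIntegers (CyclotomicField 3 ℚ)))), 𝔐.IsMaximal ∧ (3 : (integralClosure ℤ ℂ)) ∈ 𝔐 ∧ ∀ k : ℕ, ∃ P : Literature.NumberTheory.Automorphic.CuspidalAutomorphicRepData 3 (CyclotomicField 3 ℚ) hcpt, P.1.IsRegularAlgebraic ∧ ∀ 𝔭 ∉ S, ∃ (α : Multiset ℂ) (t u : (integralClosure ℤ ℂ)), P.1.HasSatakeParamAt 𝔭 α ∧ (t : ℂ) = (𝔭.residueCard : ℂ) * α.sum - e (Literature.NumberTheory.GaloisRepresentations.picardTrace f 𝔭) ∧ u ∉ 𝔐 ∧ u * t ∈ Ideal.span {(3 : (integralClosure ℤ ℂ)) ^ k}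

/-- The crux is literally `∀ f hcpt, Generic-hypotheses → ResidualHyp → LimitConcl`. -/
theorem crux_iff :
    Summit.Langlands.Langlands.Theses.PicardMuOrdinary.MuOrdinaryFamilyRT ↔
      ∀ (f : ℤ[X]) (hcpt : isCompact_glFiniteIntegralLevel 3 (CyclotomicField 3 ℚ)),
        f.natDegree = 4 → (f.map (Int.castRingHom ℚ)).Separable →
          12 ∣ Nat.card (f.map (Int.castRingHom ℚ)).Gal → ResidualHyp f hcpt → LimitConcl f hcpt :=
  Iff.rfl


/-! ## 2. Residual data: the framed heart -/

/-- The roots of `f` in `K̄` (a finite `Γ_K`-set with 4 elements for generic `f`). -/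
abbrev Roots (f : ℤ[X]) : Type := ((f.map (algebraMap ℤ K)).rootSet (AlgebraicClosure K))

/-- **The framed heart (branch-point) representation** `r̄_f^B : Γ_K → GL₃(𝔽₃)`: the tree's
`heartRep 3` on `𝔽₃^{roots}/𝔽₃·1 ≅ J(C_f)[1-ω]` (Poonen–Schaefer; `superelliptic_lambdaTorsion_iso_heart`)
in the basis `B`. -/
def rbar (f : ℤ[X]) (B : Module.Basis (Fin 3) (ZMod 3) (Heart 3 (Roots f))) :
    absoluteGaloisGroup K →* GL (Fin 3) (ZMod 3) :=
  (Units.map ((LinearMap.toMatrixAlgEquiv B).toRingEquiv.toMonoidHom)).comp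
    (heartRep 3 (Roots f) (absoluteGaloisGroup K)).asGroupHom

/-- A `3 × 3` matrix is upper triangular. -/
def IsUpper3 {R : Type*} [CommRing R] (M : Matrix (Fin 3) (Fin 3) R) : Prop :=
  M 1 0 = 0 ∧ M 2 0 = 0 ∧ M 2 1 = 0

/-! ## 2b. The scope of the line (gen 2): μ-ordinarity of `ρ_C` at `λ`, Galois side -/

/-- **`ρ` is μ-ordinary at `3`** (Galois side; the gen-2 SCOPE of the line).  At the place `v ∣ 3` of `K`
(`λ = (1 − ω)`, `K_λ = ℚ₃(ω)`) there is a frame `g` in which the whole decomposition group `Γ_{K_v}` acts upper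
triangularly (a `Γ_{K_v}`-stable full flag) such that on an open subgroup `U` of inertia one END diagonal
character (`i ∈ {0,2}`) is trivial (unit root, Hodge–Tate `(0,0)`) and the other end (`k ∈ {0,2}`, `k ≠ i`) is
`ε^s`, `s = ±1` (slope one, Hodge–Tate `(1,1)`), in either order; AND ("pure unit root") on no open subgroup
is the `k`-th diagonal character equal to `ε^s` times the `i`-th.  For the `λ`-adic representation of a Picard
curve this is Börner–Bouw–Wewers stable type (b) at `3` (Jacobian potentially good of `3`-rank `2`, Newton
polygon `(0,0,½,½,1,1)`; canonical connected–multiplicative ⊂ connected ⊂ all filtration); types (a), (c) have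
no unit root, the toric types (d), (e) fail purity.  It replaces the curve-level
`HasMuOrdinaryReductionAtThree f`, empty on `ℤ[x]` (`Negative/ScopeVacuity`); non-empty on the generic class:
`f = 3x⁴ + x³ − 54` (BBW 2017 Example 3.8, `Gal = S₄`, `disc = −2²·3⁹·5²·7·79`). -/
def IsMuOrdinaryAtThree (ρ : FramedGaloisRep K (PadicAlgCl 3) 3) : Prop :=
  ∀ v : HeightOneSpectrum (𝓞 K), (3 : 𝓞 K) ∈ v.asIdeal →
    ∃ (g : GL (Fin 3) (PadicAlgCl 3)) (U : OpenSubgroup (absoluteGaloisGroup (v.adicCompletion K)))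
      (i k : Fin 3) (s : ℤ),
      i ≠ k ∧ (i = 0 ∨ i = 2) ∧ (k = 0 ∨ k = 2) ∧ (s = 1 ∨ s = -1) ∧
      (∀ τ : absoluteGaloisGroup (v.adicCompletion K),
        IsUpper3 (g⁻¹ * ρ (absGaloisRestrict K (v.adicCompletion K) τ) * g).val) ∧
      (∀ τ ∈ absInertia (v.adicCompletion K), τ ∈ U →
        (g⁻¹ * ρ (absGaloisRestrict K (v.adicCompletion K) τ) * g).val i i = 1 ∧
        (g⁻¹ * ρ (absGaloisRestrict K (v.adicCompletion K) τ) * g).val k k =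
          algebraMap ℤ_[3] (PadicAlgCl 3)
            (((GaloisRep.cyclotomicCharacter (v.adicCompletion K) 3 τ) ^ s : ℤ_[3]ˣ) : ℤ_[3])) ∧
      (∀ U' : OpenSubgroup (absoluteGaloisGroup (v.adicCompletion K)), ∃ τ ∈ U',
        (g⁻¹ * ρ (absGaloisRestrict K (v.adicCompletion K) τ) * g).val k k ≠
          algebraMap ℤ_[3] (PadicAlgCl 3)
              (((GaloisRep.cyclotomicCharacter (v.adicCompletion K) 3 τ) ^ s : ℤ_[3]ˣ) : ℤ_[3]) *
            (g⁻¹ * ρ (absGaloisRestrict K (v.adicCompletion K) τ) * g).val i i)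

/-- **The main class** of the line: `ρ_C` is μ-ordinary at `3` (`IsMuOrdinaryAtThree`) AND the image of
`ρ̄_C|Γ_K` on the heart is all of `S₄` (`disc f ∉ ℚ^{×2} ∪ −3·ℚ^{×2}`), so that it is still `S₄` over the
auxiliary CM field `F' = K(√d)` of K1 (`A₄` is Taylor–Wiles-dead: `H¹(A₄, 𝔽₃) ≠ 0`).  Typed on the pair
`(f, ρ_C)` (`PicardInput` pins `ρ_C` up to isomorphism) to keep the glue purely logical. -/
def MainClass (f : ℤ[X]) (ρC : FramedGaloisRep K (PadicAlgCl 3) 3) : Prop :=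
  IsMuOrdinaryAtThree ρC ∧
    ¬ IsSquare (f.map (Int.castRingHom ℚ)).discr ∧
    ¬ IsSquare ((-3 : ℚ) * (f.map (Int.castRingHom ℚ)).discr)

/-! ## 3. The typed notion of the line: a B-ordinary polarized `Λ`-adic family through `ρ_C` -/

/-- **`OrdFamily f ι e S₀ ρC` — an INTEGRAL `Λ`-adic B-ordinary polarized family of `Γ_K`-representations
through `ρ_C`.**  Data: a coefficient DVR `𝒪` finite over `ℤ₃` with residue field `𝔽₃`, embedded in `ℚ̄₃` by `j`;
a complete Noetherian local DOMAIN `R` over `𝒪` with residue field `𝔽₃`; a profinitely continuous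
`ρ : Γ_K → GL₃(R)` lifting the framed heart `r̄_f^B`, unramified outside `S₀`, POLARIZED in trace form
(`tr ρ(θ_c σ) = ε(σ)^m · tr ρ(σ⁻¹)` for complex conjugations `c`); a weight algebra `Λ` — a normal Noetherian
domain of Krull dimension `≤ 4` acting on `R` with closed image — with ORDERED WEIGHT CHARACTERS `wt v i` at
`v ∣ 3`, multiplicative and continuous on inertia, whose values together with `𝒪` topologically generate the
image of `Λ` (`Λ` is THE weight algebra of the family, no bigger); `R` topologically generated over `Λ` by the
characteristic polynomials of `ρ` (Chenevier); POINTWISE B-ordinarity at `λ` at every `ℚ̄₃`-point `z`, with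
`i`-th diagonal inertial character `z ∘ wt v i`; the PICARD POINT `x : R → 𝒪` with `j ∘ x ∘ tr ρ = tr ρ_C`,
whose weight has the μ-ordinary END shape (one end trivial, the other `ε^{±1}`, on open inertia).
Intended witness: the image of an irreducible component, through `x_C`, of Geraghty's flag scheme over
`R^{univ}_{S₀,pol} ⊗̂ Λ`.  No finiteness, universality or dimension statement is part of the notion — those are
the CONTENT of K1 (`S.stub_definiteHost`) resp. K2 (`S.stub_charZeroFamily`); in particular the constant family
`R = Λ = 𝒪` is an `OrdFamily` (of dimension `1`).  Full rationale: the skeleton's docstring. -/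
structure OrdFamily (f : ℤ[X]) (ι : PadicAlgCl 3 ≃+* ℂ) (e : K →+* ℂ)
    (S₀ : Finset (HeightOneSpectrum (𝓞 K))) (ρC : FramedGaloisRep K (PadicAlgCl 3) 3) : Type 1 where
  /-- Coefficients: `𝒪 = 𝒪_{E₀}`, a DVR finite over `ℤ₃` with residue field `𝔽₃`. -/
  𝒪 : Type
  [instCommRing : CommRing 𝒪]
  [instIsDomain : IsDomain 𝒪]
  [instDVR : IsDiscreteValuationRing 𝒪]
  [instAlgebra : Algebra ℤ_[3] 𝒪]
  [instFinite : Module.Finite ℤ_[3] 𝒪]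
  [instAlgebraRes : Algebra 𝒪 (ZMod 3)]
  residue_surjective : Function.Surjective (algebraMap 𝒪 (ZMod 3))
  /-- `𝒪 ↪ ℚ̄₃`, compatibly with `ℤ₃`; values are integral (norm `≤ 1`). -/
  j : 𝒪 →+* PadicAlgCl 3
  j_injective : Function.Injective j
  j_comp : j.comp (algebraMap ℤ_[3] 𝒪) = algebraMap ℤ_[3] (PadicAlgCl 3)
  j_norm_le : ∀ a : 𝒪, ‖j a‖ ≤ 1
  /-- A basis of the heart (the residual frame) and the polarization exponent. -/
  B : Module.Basis (Fin 3) (ZMod 3) (Heart 3 (Roots f))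
  m : ℤ
  /-- The ring of the family: a complete Noetherian local `𝒪`-DOMAIN with residue field `𝔽₃`. -/
  R : Type
  [instCommRingR : CommRing R]
  [instIsDomainR : IsDomain R]
  [instIsLocalRingR : IsLocalRing R]
  [instIsNoetherianRingR : IsNoetherianRing R]
  [instAlgebraR : Algebra 𝒪 R]
  [instIsAdicCompleteR : IsAdicComplete (IsLocalRing.maximalIdeal R) R]
  π : R →ₐ[𝒪] ZMod 3
  π_surjective : Function.Surjective π
  /-- The family `ρ : Γ_K → GL₃(R)`: continuous, lifts `r̄_f^B`, unramified outside `S₀`, polarized. -/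
  ρ : absoluteGaloisGroup K →* GL (Fin 3) R
  continuous : Deformation.IsAdicContinuous ρ
  residual : ∀ σ, (ρ σ).val.map (π : R →+* ZMod 3) = (rbar f B σ).val
  unramified : ∀ v : HeightOneSpectrum (𝓞 K), v ∉ S₀ → Deformation.IsUnramifiedAt v ρ
  polarized : ∀ c : absoluteGaloisGroup ℚ, IsComplexConjugation (algebraMap ℚ ℝ) c →
    ∀ σ, (ρ (absGaloisOuterConj ℚ K c σ)).val.trace =
      algebraMap 𝒪 R (algebraMap ℤ_[3] 𝒪 (((GaloisRep.cyclotomicCharacter K 3 σ) ^ m : ℤ_[3]ˣ) : ℤ_[3])) *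
        (ρ σ⁻¹).val.trace
  /-- The weight algebra: a normal Noetherian domain of dimension `≤ 4` acting on `R`, with the
  ordered weight characters `wt v i` at the places `v ∣ 3` (junk at `v ∤ 3`). -/
  Λ : Type
  [instCommRingΛ : CommRing Λ]
  [instIsDomainΛ : IsDomain Λ]
  [instIsNoetherianRingΛ : IsNoetherianRing Λ]
  [instIsIntegrallyClosedΛ : IsIntegrallyClosed Λ]
  [instAlgebraΛ : Algebra Λ R]
  dim_le : ringKrullDim Λ ≤ (4 : ℕ)
  wt : (v : HeightOneSpectrum (𝓞 K)) → Fin 3 → absoluteGaloisGroup (v.adicCompletion K) → Λ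
  /-- The weight characters are multiplicative and (`𝔪_R`-adically) continuous on inertia. -/
  wt_mul : ∀ v : HeightOneSpectrum (𝓞 K), (3 : 𝓞 K) ∈ v.asIdeal → ∀ i : Fin 3,
    ∀ τ ∈ absInertia (v.adicCompletion K), ∀ τ' ∈ absInertia (v.adicCompletion K),
      wt v i (τ * τ') = wt v i τ * wt v i τ'
  wt_cont : ∀ v : HeightOneSpectrum (𝓞 K), (3 : 𝓞 K) ∈ v.asIdeal → ∀ (i : Fin 3) (N : ℕ),
    ∃ U : OpenSubgroup (absoluteGaloisGroup (v.adicCompletion K)),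
      ∀ τ ∈ absInertia (v.adicCompletion K), τ ∈ U →
        algebraMap Λ R (wt v i τ) - 1 ∈ IsLocalRing.maximalIdeal R ^ N
  /-- `Λ` has closed image in `R` (it is meant to be a complete local ring mapping continuously) … -/
  closedRange : ∀ r : R,
    (∀ N : ℕ, ∃ a : Λ, r - algebraMap Λ R a ∈ IsLocalRing.maximalIdeal R ^ N) →
      r ∈ (algebraMap Λ R).range
  /-- … and that image is topologically generated by `𝒪` and the values of the weight characters on
  inertia: `Λ` is THE weight algebra of the family, no bigger (this excludes `Λ := R`-type junk). -/
  weightsGenerate : ∀ (a : Λ) (N : ℕ),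
    ∃ b ∈ Algebra.adjoin ℤ
        ({c : R | ∃ (v : HeightOneSpectrum (𝓞 K)) (i : Fin 3)
            (τ : absoluteGaloisGroup (v.adicCompletion K)),
            (3 : 𝓞 K) ∈ v.asIdeal ∧ τ ∈ absInertia (v.adicCompletion K) ∧
              c = algebraMap Λ R (wt v i τ)} ∪ Set.range (algebraMap 𝒪 R)),
      algebraMap Λ R a - b ∈ IsLocalRing.maximalIdeal R ^ N
  /-- `R` is topologically generated over `Λ` by the characteristic polynomials of the family. -/
  generated : ∀ (r : R) (N : ℕ),
    ∃ a ∈ Algebra.adjoin Λ {c : R | ∃ (σ : absoluteGaloisGroup K) (i : ℕ), c = ((ρ σ).val.charpoly).coeff i},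
      r - a ∈ IsLocalRing.maximalIdeal R ^ N
  /-- Pointwise B-ordinarity at `λ` with ordered diagonal inertial characters `z ∘ wt v i`. -/
  ordinaryAt : ∀ (z : R →+* PadicAlgCl 3) (v : HeightOneSpectrum (𝓞 K)), (3 : 𝓞 K) ∈ v.asIdeal →
    ∃ g : GL (Fin 3) (PadicAlgCl 3),
      (∀ τ, IsUpper3 (g⁻¹ * Matrix.GeneralLinearGroup.map z
        (ρ (absGaloisRestrict K (v.adicCompletion K) τ)) * g).val) ∧
      ∀ τ ∈ absInertia (v.adicCompletion K), ∀ i : Fin 3,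
        (g⁻¹ * Matrix.GeneralLinearGroup.map z (ρ (absGaloisRestrict K (v.adicCompletion K) τ)) * g).val
            i i = z (algebraMap Λ R (wt v i τ))
  /-- The Picard point: `x ∘ ρ` has the traces of `ρ_C`. -/
  x : R →ₐ[𝒪] 𝒪
  x_trace : ∀ σ : absoluteGaloisGroup K, j (x (ρ σ).val.trace) = FramedRep.trace ρC σ
  /-- μ-ordinary end shape of the weight of `x`: on an open subgroup of inertia at `λ`, one end
  character is trivial and the other is `ε^{±1}`. -/
  ends : ∀ v : HeightOneSpectrum (𝓞 K), (3 : 𝓞 K) ∈ v.asIdeal →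
    ∃ (U : OpenSubgroup (absoluteGaloisGroup (v.adicCompletion K))) (i k : Fin 3) (s : ℤ),
      i ≠ k ∧ (i = 0 ∨ i = 2) ∧ (k = 0 ∨ k = 2) ∧ (s = 1 ∨ s = -1) ∧
      ∀ τ ∈ absInertia (v.adicCompletion K), τ ∈ U →
        j (x (algebraMap Λ R (wt v i τ))) = 1 ∧
        j (x (algebraMap Λ R (wt v k τ))) =
          algebraMap ℤ_[3] (PadicAlgCl 3)
            (((GaloisRep.cyclotomicCharacter (v.adicCompletion K) 3 τ) ^ s : ℤ_[3]ˣ) : ℤ_[3])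

attribute [instance] OrdFamily.instCommRing OrdFamily.instIsDomain OrdFamily.instDVR
  OrdFamily.instAlgebra OrdFamily.instFinite OrdFamily.instAlgebraRes
  OrdFamily.instCommRingR OrdFamily.instIsDomainR OrdFamily.instIsLocalRingR
  OrdFamily.instIsNoetherianRingR OrdFamily.instAlgebraR OrdFamily.instIsAdicCompleteR
  OrdFamily.instCommRingΛ OrdFamily.instIsDomainΛ OrdFamily.instIsNoetherianRingΛ
  OrdFamily.instIsIntegrallyClosedΛ OrdFamily.instAlgebraΛ

/-! ## 4. Dominance is free: the kernel-checked algebra of the line -/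

/-- **Dominance lemma (proved, no stub).**  If `Λ` is a domain of Krull dimension `≤ n`, `R` a
domain of Krull dimension `≥ n`, and `R` is module-finite over `Λ`, then `Λ → R` is injective: else
`R` would be integral over the proper quotient `Λ ⧸ ker`, of dimension `≤ n - 1` (incomparability,
`Literature.RingTheory.KrullDimension.ringKrullDim_le_of_isIntegral`; a non-zero prime of a domain drops
the dimension, `ringKrullDim_quotient_add_one_le`).  With `n = 4 = 1 + rank of weight space` this is
"the component of `ρ_C` DOMINATES weight space" — the conjunct the Disproof proved load-bearing
(`stub_accumulation_false_without_dominance`, p74393) — obtained from the characteristic-zero count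
(`stub_charZeroFamily`) and finiteness (`stub_definiteHost`). [folklore] -/
theorem algebraMap_injective_of_ringKrullDim_le : ∀ {Λ R : Type} [CommRing Λ] [IsDomain Λ] [CommRing R] [Algebra Λ R] [Module.Finite Λ R] {n : ℕ}, ringKrullDim Λ ≤ n → (n : WithBot ℕ∞) ≤ ringKrullDim R → Function.Injective (algebraMap Λ R) := by
  intro Λ R _ _ _ _ _ n hΛ hR
  rw [RingHom.injective_iff_ker_eq_bot]
  by_contra hker
  have hcomap : (⊥ : Ideal R).comap (algebraMap Λ R) = RingHom.ker (algebraMap Λ R) := by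
    rw [← RingHom.ker_eq_comap_bot]
  have h1 : ringKrullDim (R ⧸ (⊥ : Ideal R)) ≤
      ringKrullDim (Λ ⧸ (⊥ : Ideal R).comap (algebraMap Λ R)) :=
    Literature.RingTheory.KrullDimension.ringKrullDim_le_of_isIntegral
  have h2 : ringKrullDim (Λ ⧸ (⊥ : Ideal R).comap (algebraMap Λ R)) + 1 ≤ ringKrullDim Λ :=
    Literature.RingTheory.KrullDimension.ringKrullDim_quotient_add_one_le (by rwa [hcomap])
  have h3 : ringKrullDim (R ⧸ (⊥ : Ideal R)) = ringKrullDim R :=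
    ringKrullDim_eq_of_ringEquiv (RingEquiv.quotientBot R)
  have h4 : (n : WithBot ℕ∞) + 1 ≤ n :=
    calc (n : WithBot ℕ∞) + 1 ≤ ringKrullDim R + 1 := add_le_add hR le_rfl
      _ = ringKrullDim (R ⧸ (⊥ : Ideal R)) + 1 := by rw [h3]
      _ ≤ ringKrullDim (Λ ⧸ (⊥ : Ideal R).comap (algebraMap Λ R)) + 1 := add_le_add h1 le_rfl
      _ ≤ ringKrullDim Λ := h2
      _ ≤ n := hΛ
  have h5 : ((n + 1 : ℕ) : WithBot ℕ∞) ≤ ((n : ℕ) : WithBot ℕ∞) := by exact_mod_cast h4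
  have h6 : n + 1 ≤ n := by exact_mod_cast h5
  omega

/-! ## 5. Statements of the open stubs (K2, K1, remainder) and of the two fact stubs -/

/-- **K2 — `S.stub_charZeroFamily` (THE LEVER; the card's K2; size L, research-adjacent).**  For generic `f`
whose `ρ_C` (Stub 1) is μ-ordinary at `3` there is an `OrdFamily` through `ρ_C` whose ring `R` (a domain) has
Krull dimension `≥ 4` (`= 1 + rank` of the polarized ordinary weight space of `U(3)`).  Intended proof: the
universal polarized `S₀`-unramified deformation ring of `r̄` (tree: `polarizedDeformationRing_nonempty`,
`Literature/…/PolarizedDeformationRing.lean`) tensored with the Iwasawa branch `Λ ≅ 𝒪⟦X₁,X₂,X₃⟧`;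
Geraghty's proper flag scheme `𝒢` at `λ`; KISIN at the CHARACTERISTIC-ZERO point `x_C` (the flag of `ρ_C`
deforms uniquely, `H⁰(G_{ℚ₃}, ad/𝔟) = 0`) with the Poitou–Tate / Greenberg–Wiles count with `E`-coefficients
`g − r ≥ 0 − 0 + 6 − 3 = 3` (`h⁰(ad ρ_C(1)) = 0` — the residual `μ₃`-deficit is invisible at the motive; local
term by Hodge–Tate weights and PURITY of the unit root; archimedean `3`); the witness `R := (R^{univ} ⊗̂ Λ)/𝔮`,
`𝔮` the contraction of the analytic branch through `x_C`, `dim R ≥ 3 + 1` by catenarity.  Missing Literature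
pieces and sources (Kisin 2008 §2.3; Allen arXiv:1411.7661; Geraghty 2019 §3; CHT 2008 §2.2–2.3; Chenevier
arXiv:0809.0415; Matsumura Thms 15.6, 31.6–31.7): evidence file `stub_charZeroFamily_report.md` of the item. -/
def S.stub_charZeroFamily : Prop :=
  ∀ (f : ℤ[X]) (ι : PadicAlgCl 3 ≃+* ℂ) (e : K →+* ℂ) (S₀ : Finset (HeightOneSpectrum (𝓞 K)))
    (ρC : FramedGaloisRep K (PadicAlgCl 3) 3),
    Generic f → PicardInput f ι e S₀ ρC → IsMuOrdinaryAtThree ρC →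
    ∃ 𝓕 : OrdFamily f ι e S₀ ρC, ((4 : ℕ) : WithBot ℕ∞) ≤ ringKrullDim 𝓕.R

/-- **K1 — `S.stub_definiteHost` (THE HOST OVER `F'`; the card's K1 = weight-blind's K1; size XL, crux-sized
but smaller than the crux).**  For `(f, ρ_C)` in the main class and EVERY `OrdFamily 𝓕` through `ρ_C` OF KRULL
DIMENSION `≥ 4`: (i) `𝓕.R` is module-finite over `𝓕.Λ`; (ii) there are a quadratic `F'/K` (intended `K(√d)`,
`d ≡ 6 mod 9`: `λ` and all of `S₀` split in `F'/ℚ(√d)`, `F'_w = K_λ`, `ρ̄_C(Γ_{F'}) = S₄`), a level `S'` above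
`S₀`, a finite `E/ℚ₃` and a set `D` of `E`-integral arithmetic weights accumulating UNIFORMLY at the weight of
the Picard point, such that every `ℚ̄₃`-point `y` of `𝓕.R` over `D` is CLASSICAL OVER `F'`: `y ∘ tr ρ = tr ρ_y`
with `ρ_y|Γ_{F'}` absolutely irreducible and attached (lang.S27 compatibility at `w ∉ S'`, `w ∤ 3`) to a
regular algebraic cuspidal `P'_y` of `GL₃(𝔸_{F'})`, unramified outside `S'`, with integrally normalised Satake
parameters.  Intended proof: `𝓕.R` is a quotient of `R^△_K ⊗̂ Λ` (`generated`, `ordinaryAt` at the Zariski-dense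
`ℚ̄₃`-points of the domain); `R^△_K` finite over `R^△_{F'}`; `R^{△,red}_{F'} = T^{ord}_{F'}` — Geraghty-type
`Λ`-adic ordinary patching on the DEFINITE `U(3)_{F'/ℚ(√d)}` at the SPLIT prime `3`, with `p = n = 3`, `ζ₃ ∈ F'`,
image `S₄` (`ad/𝔷`-adequate over `𝔽₉`): EVERY printed hypothesis of Thorne 2012 / Geraghty 2019 / BLGGT fails,
so this is an `R = T` theorem to be proved, not cited; classicality by Hida–Geraghty control + Labesse base
change + lang.S27.  RESHAPES: (lead b-0) per-eigenvalue integrality added for `stub_quadraticDescent`; (lead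
c1) hypothesis `4 ≤ ringKrullDim 𝓕.R` added — without it the statement is FALSE IN TRUTH by the constant family
`R = Λ = 𝒪` (it would attach the irregular `ρ_C|Γ_{F'}` to a REGULAR algebraic cuspidal `P'`); the composition
only applies K1 to the family of K2.  Analysis: evidence file `stub_definiteHost_analysis.md` of the item. -/
def S.stub_definiteHost : Prop :=
  ∀ (f : ℤ[X]) (ι : PadicAlgCl 3 ≃+* ℂ) (e : K →+* ℂ) (S₀ : Finset (HeightOneSpectrum (𝓞 K)))
    (ρC : FramedGaloisRep K (PadicAlgCl 3) 3) (𝓕 : OrdFamily f ι e S₀ ρC),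
    Generic f → PicardInput f ι e S₀ ρC → MainClass f ρC →
    ((4 : ℕ) : WithBot ℕ∞) ≤ ringKrullDim 𝓕.R →
    Module.Finite 𝓕.Λ 𝓕.R ∧
    ∃ (F' : Type) (_ : Field F') (_ : NumberField F') (_ : Algebra K F')
      (hcpt' : isCompact_glFiniteIntegralLevel 3 F') (S' : Finset (HeightOneSpectrum (𝓞 F')))
      (D : Set (𝓕.Λ →+* PadicAlgCl 3)) (E : IntermediateField ℚ_[3] (PadicAlgCl 3)),
      Module.finrank K F' = 2 ∧ FiniteDimensional ℚ_[3] E ∧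
      (∀ w : HeightOneSpectrum (𝓞 F'), w.under (𝓞 K) ∈ S₀ → w ∈ S') ∧
      (∀ κ ∈ D, ∀ a : 𝓕.Λ, κ a ∈ E ∧ ‖κ a‖ ≤ 1) ∧
      (∀ M : ℕ, ∃ κ ∈ D, ∀ a : 𝓕.Λ,
        ‖κ a - 𝓕.j (𝓕.x (algebraMap 𝓕.Λ 𝓕.R a))‖ ≤ ((3 : ℝ)⁻¹) ^ M) ∧
      (∀ y : 𝓕.R →+* PadicAlgCl 3, y.comp (algebraMap 𝓕.Λ 𝓕.R) ∈ D →
        ∃ ρy : FramedGaloisRep K (PadicAlgCl 3) 3,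
          (∀ g, FramedRep.trace ρy g = y (𝓕.ρ g).val.trace) ∧
          FramedRep.IsAbsolutelyIrreducible (ρy.restrictField F') ∧
          ∃ P' : CuspidalAutomorphicRepData 3 F' hcpt',
            P'.1.IsRegularAlgebraic ∧
            ∀ w ∉ S', (∃ α : Multiset ℂ, P'.1.HasSatakeParamAt w α ∧
                ∀ a ∈ α, IsIntegral ℤ ((w.residueCard : ℂ) * a)) ∧
              (((3 : ℕ) : 𝓞 F') ∉ w.asIdeal → IsGaloisCompatibleAt P'.1 ι (ρy.restrictField F') w))

/-- **`S.stub_remainder` — NOT a lemma of the line: the conceded complement.**  The crux verbatim for generic `f`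
with its Picard representation `ρ_C` OUTSIDE the main class: `ρ_C` not μ-ordinary at `3` (BBW types (a), (c):
λ-supersingular, no engine in any line — the route's foreseen `RTSupersingular`; (d), (e): toric, purity fails)
or `ρ̄_C(Γ_K) = A₄`.  Registered only so that the composition concludes the crux BY NAME; to be promoted to the
planned split of the crux (route two-layer plan (1), kill criterion 4), never proved inside this line. -/
def S.stub_remainder : Prop :=
  ∀ (f : ℤ[X]) (hcpt : isCompact_glFiniteIntegralLevel 3 (CyclotomicField 3 ℚ))
    (ι : PadicAlgCl 3 ≃+* ℂ) (e : K →+* ℂ) (S₀ : Finset (HeightOneSpectrum (𝓞 K)))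
    (ρC : FramedGaloisRep K (PadicAlgCl 3) 3),
    Generic f → PicardInput f ι e S₀ ρC → ¬ MainClass f ρC → ResidualHyp f hcpt → LimitConcl f hcpt

/-- FACT STUB A — the one Literature input of the landed conditional discharge `stub_picardInput_of` (p86963) of
Stub 1: the `λ`-adic representation of a Picard curve (named fact `picardCurve_exists_lambdaAdicRep`, Upton 2009 /
Serre–Tate / SGA 4½; not constructible in the tree: no étale `H¹` of curves of genus `> 1`). -/
def S.stub_picardFact : Prop :=
  Literature.NumberTheory.GaloisRepresentations.picardCurve_exists_lambdaAdicRep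

/-- FACT STUB B — five of the six Literature inputs of the landed conditional discharge `stub_quadraticDescent_of`
(p90012) of Stub 5 (trace formula / HLTT–Scholze; dischargeable only by proving them): Arthur–Clozel strong lifting
at unramified places, cyclic cuspidal descent (reduced in the tree to seven leaves, `cuspidal_descent_cyclic_of_clean_leaves`),
strong lifting at the archimedean places, existence of infinity types, lang.S27.  The sixth, the quadratic-sign twist,
is the tree's theorem `exists_twist_quadraticSign_holds` and is fed to the composition directly (third lead's reshape). -/
def S.stub_descentFacts : Prop :=
  Literature.NumberTheory.Automorphic.ArthurClozel1989_strongLifting_unramified ∧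
  cuspidal_descent_cyclic ∧ ArthurClozel1989_strongLifting_archimedean ∧
  (∀ (N : ℕ) (M : Type) [Field M] [NumberField M] (hM : isCompact_glFiniteIntegralLevel N M)
      (Q : AutomorphicRepData (AutomorphyDatum.gl N M hM)), Q.exists_hasInfinityType) ∧
  exists_galoisRep_of_regularAlgebraic

end

end Summit.Langlands.Langlands.Cruxes.MuOrdinaryFamilyRT.CharZeroDominance
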